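import Literature.Probability.LatticeModels.MeshStrayParity
import Literature.Probability.LatticeModels.MeshGoodColumn
import Literature.Probability.LatticeModels.MeshWindows
import Literature.Probability.LatticeModels.MeshDomainBulk
import HarnessLib

/-!
# Stray mesh components of a Jordan domain have small horizontal extent

Topic: Probability / LatticeModels (seventh file of the "bulk = largest mesh component for every
Jordan domain" theorem, `MeshDomainJordan.lean`; sub-namespace `…LatticeModels.Mesh`).

**Theorem** (`JordanDomain.mul_sub_lt_of_stray`). Let `D` be a Jordan domain and `D₀ > 0`.
There are `ε > 0` and `δ₀ > 0` such that for every mesh `0 < δ < δ₀`: if `x`, `y` are mesh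
vertices joined in the mesh graph on mesh vertices, and *every* vertex joined to `x` has its mesh
point at distance `< ε` from `Ωᶜ` (the component of `x` is *stray*: it avoids the `ε`-bulk), then
`δ (y₀ - x₀) < D₀`.

Proof (assembling the previous files). Suppose `δ (y₀ - x₀) ≥ D₀`. With `η` a modulus of uniform
local connectedness of the exterior at radius `D₀/16` (`ExteriorULC.lean`) and
`M = ⌊η / 16δ⌋`, the `≥ D₀/8δ` columns `k` with `δ(k + ½)` at horizontal distance `≥ 3D₀/8`
from both `δx` and `δy` cannot all contain a run of `M` consecutive *shallow* perfect cells
(corners within `ε` of `Ωᶜ`): those cells would be disjoint subsets of the inner collar of width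
`ε + 2δ`, whose area was chosen `< D₀ η · area B(0,1) / 2048` (`MeshGoodColumn.lean`). Fix such a
good column `k` and a walk `W` from `x` to `y` in the mesh graph. It traverses an odd number of
rungs of column `k` (`odd_kRungCount`). Group these rungs by the window of the column they lie
in (`MeshWindows.lean`): a window met by `W` consists of perfect cells whose corners are joined
to `x` (ladder), hence shallow, hence fewer than `M` of them — the window is short — so by
`even_windowRungCount` (`MeshStrayParity.lean`) it is crossed an even number of times. Summing
over windows, the total is even: contradiction.

Folklore (no source treats lattice-point counts of mesh components of Jordan domains; this is the
deterministic input of the RSW corollary `discreteCrossingProb_clusterPt_mem_Ioo` for the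
"largest component" discretisation). Mathlib anchors: `Nat.floor`, `Int.ceil`, `Finset.Icc`,
`List.countP`. H21 anchors: the `Mesh.*` files above, `exists_pos_volume_real_innerCollar_lt`
(`MeshDomainBulk.lean`), `JordanDomain.exterior_joinedIn_of_dist_lt` (`ExteriorULC.lean`).
-/

namespace Literature.Probability.LatticeModels.Mesh

open Set Metric MeasureTheory Literature.Probability.RandomPlanarGeometry

noncomputable section

variable {Ω : Set ℂ} {δ : ℝ}

/-! ### From walks on mesh vertices to lattice walks -/

/-- A walk in the mesh graph on mesh vertices is a lattice walk through mesh vertices joined to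
its origin, along mesh edges. [folklore] -/
theorem exists_zdWalk {x y : meshVertices Ω δ} (P : (meshVertexGraph Ω δ).Walk x y) :
    ∃ W : (zdGraph 2).Walk (x : Site 2) (y : Site 2),
      (∀ a ∈ W.support, ∃ ha : a ∈ meshVertices Ω δ, (meshVertexGraph Ω δ).Reachable x ⟨a, ha⟩) ∧
      ∀ d ∈ W.darts, (meshGraph Ω δ).Adj d.fst d.snd := by
  induction P with
  | nil =>
    refine ⟨SimpleGraph.Walk.nil, fun a ha => ?_, fun d hd => by simp at hd⟩
    rw [SimpleGraph.Walk.support_nil, List.mem_singleton] at ha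
    subst ha
    exact ⟨_, SimpleGraph.Reachable.refl _⟩
  | @cons a b c h P ih =>
    obtain ⟨W, hWs, hWd⟩ := ih
    have hab : (meshGraph Ω δ).Adj (a : Site 2) (b : Site 2) := h
    refine ⟨SimpleGraph.Walk.cons (meshGraph_le_zdGraph Ω δ hab) W, fun v hv => ?_, fun d hd => ?_⟩
    · rw [SimpleGraph.Walk.support_cons, List.mem_cons] at hv
      rcases hv with rfl | hv
      · exact ⟨a.2, SimpleGraph.Reachable.refl _⟩
      · obtain ⟨hv', hr⟩ := hWs v hv
        exact ⟨hv', h.reachable.trans hr⟩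
    · rw [SimpleGraph.Walk.darts_cons, List.mem_cons] at hd
      rcases hd with rfl | hd
      · exact hab
      · exact hWd d hd

/-- Horizontal separation controls the distance to a cell centre. [folklore] -/
theorem le_dist_cellCenter_of_le_abs {δ c : ℝ} {u : Site 2} {k j : ℤ}
    (h : c ≤ |δ * u 0 - δ * (k + 1 / 2)|) : c ≤ dist (meshPoint δ u) (cellCenter δ k j) := by
  rw [Complex.dist_eq]
  refine h.trans ((Complex.abs_re_le_norm _).trans' ?_)
  rw [Complex.sub_re, meshPoint_re, cellCenter_re]

/-! ### Corners of a window are joined to any traversed rung -/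

/-- In a window `(b, t)` of column `k` (cells strictly between `b` and `t` perfect) containing at
least one perfect cell, every corner of every perfect cell of the window is joined, in the mesh
graph on mesh vertices, to the left end of any rung `j'` of the window (`b < j' ≤ t`).
[folklore] -/
theorem reachable_corner_of_window (hδ : 0 < δ) {k b t : ℤ}
    (hwin : ∀ i, b < i → i < t → IsPerfect Ω δ k i) {j' : ℤ} (h1 : b < j') (h2 : j' ≤ t)
    (hbt : b + 1 < t) (hl : corner k j' false false ∈ meshVertices Ω δ) {i : ℤ} (hi1 : b < i)
    (hi2 : i < t) (a c : Bool) :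
    ∃ hmem : corner k i a c ∈ meshVertices Ω δ,
      (meshVertexGraph Ω δ).Reachable ⟨corner k j' false false, hl⟩ ⟨corner k i a c, hmem⟩ := by
  -- the ladder of the run `b + 1, …, t - 1`
  set n : ℕ := (t - b - 2).toNat with hn
  have hn' : (n : ℤ) = t - b - 2 := Int.toNat_of_nonneg (by omega)
  have hrun : ∀ m' : ℕ, m' ≤ n → IsPerfect Ω δ k (b + 1 + m') := fun m' hm' =>
    hwin _ (by omega) (by omega)
  have hbase : ∀ (m' : ℕ) (hm' : m' ≤ n) (a'' b'' : Bool), (meshVertexGraph Ω δ).Reachable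
      ⟨corner k (b + 1) false false, by simpa using (hrun 0 (Nat.zero_le _)).2 false false⟩
      ⟨corner k (b + 1 + m') a'' b'', (hrun m' hm').2 a'' b''⟩ := fun m' hm' a'' b'' =>
    reachable_of_perfect_run hδ (j₁ := b + 1) hrun hm' a'' b''
  -- the target corner
  set mi : ℕ := (i - b - 1).toNat with hmi
  have hmi' : (mi : ℤ) = i - b - 1 := Int.toNat_of_nonneg (by omega)
  have hmin : mi ≤ n := by omega
  have hieq : i = b + 1 + mi := by omega
  have htarget := hbase mi hmin a c
  have hmem : corner k i a c ∈ meshVertices Ω δ := by rw [hieq]; exact (hrun mi hmin).2 a c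
  have htgt : (⟨corner k (b + 1 + mi) a c, (hrun mi hmin).2 a c⟩ : meshVertices Ω δ) =
      ⟨corner k i a c, hmem⟩ := Subtype.ext (congrArg (fun i' => corner k i' a c) hieq.symm)
  rw [htgt] at htarget
  -- the left end of rung `j'`
  have hsrc : (meshVertexGraph Ω δ).Reachable
      ⟨corner k (b + 1) false false, by simpa using (hrun 0 (Nat.zero_le _)).2 false false⟩
      ⟨corner k j' false false, hl⟩ := by
    by_cases hlast : j' = t
    · have heq : corner k j' false false = corner k (b + 1 + n) false true := by
        rw [corner_top_eq]; congr 1; omega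
      have hmem' : corner k (b + 1 + n) false true ∈ meshVertices Ω δ := (hrun n le_rfl).2 false true
      have : (⟨corner k j' false false, hl⟩ : meshVertices Ω δ) =
          ⟨corner k (b + 1 + n) false true, hmem'⟩ := Subtype.ext heq
      rw [this]; exact hbase n le_rfl false true
    · set m' : ℕ := (j' - b - 1).toNat with hm'
      have hm'' : (m' : ℤ) = j' - b - 1 := Int.toNat_of_nonneg (by omega)
      have hm'n : m' ≤ n := by omega
      have heq : corner k j' false false = corner k (b + 1 + m') false false := by
        congr 1; omega
      have hmem' : corner k (b + 1 + m') false false ∈ meshVertices Ω δ := (hrun m' hm'n).2 false false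
      have : (⟨corner k j' false false, hl⟩ : meshVertices Ω δ) =
          ⟨corner k (b + 1 + m') false false, hmem'⟩ := Subtype.ext heq
      rw [this]; exact hbase m' hm'n false false
  exact ⟨hmem, hsrc.symm.trans htarget⟩

/-! ### One window of a good column is crossed an even number of times -/

open Classical in
/-- **Evenness, window by window.** In the setting of `even_windowRungCount` (`D` a Jordan domain,
`η ≤ D₀/16` a modulus of local connectedness of the exterior at radius `D₀/16`), let `(b, t)` be a
window of column `k`, let `M : ℕ` with `δ M + 8δ < η`, suppose the column is *good at `b`* (the
`M` cells above `b` are not all perfect with corners within `ε` of `Ωᶜ`), and let `W` be a lattice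
walk through mesh vertices, along mesh edges, all of whose vertices are joined to a vertex `x`
whose whole component is within `ε` of `Ωᶜ`, with both ends at distance `≥ D₀/8` from the centre
of cell `(k, b)`. Then `W` traverses the rungs `b < j' ≤ t` of column `k` an even number of
times: either none is traversed, or the window touches the component of `x`, so its perfect
cells are shallow and hence fewer than `M` — the window is short and `even_windowRungCount`
applies. [folklore] -/
theorem even_windowRungCount_of_good (D : JordanDomain) {δ D₀ η ε : ℝ} (hδ : 0 < δ)
    (hηD : η ≤ D₀ / 16)
    (hulc : ∀ p ∈ (closure D.carrier)ᶜ, ∀ q ∈ (closure D.carrier)ᶜ, dist p q < η →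
      JoinedIn ((closure D.carrier)ᶜ ∩ ball p (D₀ / 16)) p q)
    {k b t : ℤ} (hbt : b < t) (hnb : ¬ IsPerfect D.carrier δ k b) (hnt : ¬ IsPerfect D.carrier δ k t)
    (hwin : ∀ i, b < i → i < t → IsPerfect D.carrier δ k i) {M : ℕ} (hM8 : δ * M + 8 * δ < η)
    (hgood : ¬ ∀ m : ℕ, m < M → IsPerfect D.carrier δ k (b + 1 + m) ∧
      ∀ a c : Bool, infDist (meshPoint δ (corner k (b + 1 + m) a c)) D.carrierᶜ < ε)
    {x : meshVertices D.carrier δ}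
    (hstray : ∀ z : meshVertices D.carrier δ, (meshVertexGraph D.carrier δ).Reachable x z →
      infDist (meshPoint δ (z : Site 2)) D.carrierᶜ < ε)
    {u v : Site 2} (W : (zdGraph 2).Walk u v)
    (hWs : ∀ a ∈ W.support, ∃ ha : a ∈ meshVertices D.carrier δ,
      (meshVertexGraph D.carrier δ).Reachable x ⟨a, ha⟩)
    (hWd : ∀ d ∈ W.darts, (meshGraph D.carrier δ).Adj d.fst d.snd)
    (hu : D₀ / 8 ≤ dist (meshPoint δ u) (cellCenter δ k b))
    (hv : D₀ / 8 ≤ dist (meshPoint δ v) (cellCenter δ k b)) :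
    Even (W.edges.countP fun e => decide (∃ j', b < j' ∧ j' ≤ t ∧ e = rung k j')) := by
  by_cases hzero : (W.edges.countP fun e => decide (∃ j', b < j' ∧ j' ≤ t ∧ e = rung k j')) = 0
  · rw [hzero]; exact ⟨0, rfl⟩
  obtain ⟨e, he, hpe⟩ := List.countP_pos_iff.1 (Nat.pos_of_ne_zero hzero)
  simp only [decide_eq_true_eq] at hpe
  obtain ⟨j', hj'1, hj'2, hej⟩ := hpe
  have he' : s(corner k j' false false, corner k j' true false) ∈ W.edges := by
    rw [hej, rung] at he; exact he
  obtain ⟨hl, hreachl⟩ := hWs (corner k j' false false) (W.fst_mem_support_of_mem_edges he')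
  -- the window is short
  have hshortZ : t - b ≤ M := by
    by_contra hlong
    push Not at hlong
    apply hgood
    intro m hm
    have hmZ : (m : ℤ) < M := by exact_mod_cast hm
    refine ⟨hwin _ (by omega) (by omega), fun a c => ?_⟩
    obtain ⟨hmem, hr⟩ := reachable_corner_of_window hδ hwin hj'1 hj'2 (by omega) hl
      (i := b + 1 + m) (by omega) (by omega) a c
    exact hstray ⟨corner k (b + 1 + m) a c, hmem⟩ (hreachl.trans hr)
  have hshort : δ * (t - b) + 8 * δ < η := by
    have : δ * ((t : ℝ) - b) ≤ δ * M :=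
      mul_le_mul_of_nonneg_left (by exact_mod_cast hshortZ) hδ.le
    linarith
  exact even_windowRungCount D hδ hηD hulc hbt hnb hnt hshort W (fun a ha => (hWs a ha).1) hWd hu hv

/-! ### A good column is crossed an even number of times -/

open Classical in
/-- **All windows at once.** In the setting of `even_windowRungCount_of_good`, if the column `k`
is good at *every* height (no `M` consecutive shallow perfect cells anywhere) and both ends of
`W` are at horizontal distance `≥ 3D₀/8` from the line `re z = δ(k + ½)`, then `W` traverses
the rungs of column `k` an even number of times: group the rungs by windows
(`countP_isKRung_eq_sum`) and apply `even_windowRungCount_of_good` to each window.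
[folklore] -/
theorem even_kRungCount_of_good (D : JordanDomain) {δ D₀ η ε : ℝ} (hδ : 0 < δ) (hD₀ : 0 < D₀)
    (hηD : η ≤ D₀ / 16)
    (hulc : ∀ p ∈ (closure D.carrier)ᶜ, ∀ q ∈ (closure D.carrier)ᶜ, dist p q < η →
      JoinedIn ((closure D.carrier)ᶜ ∩ ball p (D₀ / 16)) p q)
    {k : ℤ} {M : ℕ} (hM8 : δ * M + 8 * δ < η)
    (hgood : ∀ j : ℤ, ¬ ∀ m : ℕ, m < M → IsPerfect D.carrier δ k (j + 1 + m) ∧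
      ∀ a c : Bool, infDist (meshPoint δ (corner k (j + 1 + m) a c)) D.carrierᶜ < ε)
    {x : meshVertices D.carrier δ}
    (hstray : ∀ z : meshVertices D.carrier δ, (meshVertexGraph D.carrier δ).Reachable x z →
      infDist (meshPoint δ (z : Site 2)) D.carrierᶜ < ε)
    {u v : Site 2} (W : (zdGraph 2).Walk u v)
    (hWs : ∀ a ∈ W.support, ∃ ha : a ∈ meshVertices D.carrier δ,
      (meshVertexGraph D.carrier δ).Reachable x ⟨a, ha⟩)
    (hWd : ∀ d ∈ W.darts, (meshGraph D.carrier δ).Adj d.fst d.snd)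
    (hu : 3 * D₀ / 8 ≤ |δ * u 0 - δ * (k + 1 / 2)|) (hv : 3 * D₀ / 8 ≤ |δ * v 0 - δ * (k + 1 / 2)|) :
    Even (kRungCount k W) := by
  have hΩb : Bornology.IsBounded D.carrier := D.isBounded
  -- windows of the column, and the sum decomposition
  choose wb wt hwb hwt hnb hnt hwin using fun j => exists_window hΩb hδ k j
  set HB : Finset ℤ := (W.support.map fun a => a 1).toFinset with hHB
  set B : Finset ℤ := HB.image wb with hB
  have hBkey : ∀ e ∈ W.edges, ∀ j, e = rung k j → wb j ∈ B := by
    intro e he j hej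
    have he' : s(corner k j false false, corner k j true false) ∈ W.edges := by
      rw [hej, rung] at he; exact he
    refine Finset.mem_image.2 ⟨j, ?_, rfl⟩
    rw [hHB, List.mem_toFinset, List.mem_map]
    exact ⟨corner k j false false, W.fst_mem_support_of_mem_edges he', by simp [corner]⟩
  have hsum := countP_isKRung_eq_sum k wb B W.edges hBkey
  -- every window met is crossed an even number of times
  have heven : ∀ b ∈ B, Even (W.edges.countP fun e => decide (∃ j, e = rung k j ∧ wb j = b)) := by
    intro b hb
    obtain ⟨j₁, -, rfl⟩ := Finset.mem_image.1 hb
    have hiff : ∀ e, (∃ j, e = rung k j ∧ wb j = wb j₁) ↔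
        ∃ j', wb j₁ < j' ∧ j' ≤ wt j₁ ∧ e = rung k j' := by
      intro e
      constructor
      · rintro ⟨j, rfl, hj⟩
        have ht : wt j = wt j₁ := by
          by_contra hne'
          rcases lt_or_gt_of_ne hne' with h | h
          · exact hnt j (hwin j₁ (wt j) (by rw [← hj]; exact (hwb j).trans_le (hwt j)) h)
          · exact hnt j₁ (hwin j (wt j₁) (by rw [hj]; exact (hwb j₁).trans_le (hwt j₁)) h)
        exact ⟨j, hj ▸ hwb j, ht ▸ hwt j, rfl⟩
      · rintro ⟨j', h1, h2, rfl⟩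
        exact ⟨j', rfl, (window_eq_of_mem (hnb j') (hnt j') (hwin j') (hnb j₁) (hnt j₁) (hwin j₁)
          (hwb j') (hwt j') h1 h2).1⟩
    have hcongr : (W.edges.countP fun e => decide (∃ j, e = rung k j ∧ wb j = wb j₁)) =
        W.edges.countP fun e => decide (∃ j', wb j₁ < j' ∧ j' ≤ wt j₁ ∧ e = rung k j') :=
      List.countP_congr fun e _ => by simp only [hiff e]
    rw [hcongr]
    exact even_windowRungCount_of_good D hδ hηD hulc ((hwb j₁).trans_le (hwt j₁)) (hnb j₁) (hnt j₁)
      (hwin j₁) hM8 (hgood (wb j₁)) hstray W hWs hWd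
      (le_dist_cellCenter_of_le_abs (by linarith [hu])) (le_dist_cellCenter_of_le_abs (by linarith [hv]))
  show Even (W.edges.countP fun e => decide (IsKRung k e))
  rw [hsum]
  exact Finset.even_sum _ fun b hb => heven b hb

/-! ### Choosing the constants and the good column -/

/-- **Arithmetic of the good column.** Given the scales (`0 < δ`, `δ < η/64`, `δ < D₀/64`,
`δ ≤ r/4`), two integers `x0 ≤ y0` with `D₀ ≤ δ (y0 - x0)`, and the area bound
`area {z ∈ Ω | infDist z Ωᶜ < r} < D₀ η area(B(0,1)) / 2048`, there are a column `k` strictly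
between them, at horizontal distance `≥ 3D₀/8` from both, and `M : ℕ` with `δ M + 8δ < η`, such
that column `k` contains no `M` consecutive perfect cells with all corners within `r/2` of `Ωᶜ`.
[folklore] -/
theorem exists_goodColumn {Ω : Set ℂ} (hΩb : Bornology.IsBounded Ω) {δ η D₀ r : ℝ} (hδ : 0 < δ)
    (hη : 0 < η) (hD₀ : 0 < D₀) (hδη : δ < η / 64) (hδD : δ < D₀ / 64) (hδr : δ ≤ r / 4)
    (hcollar : volume.real {z ∈ Ω | infDist z Ωᶜ < r} <
      D₀ * η * volume.real (ball (0 : ℂ) 1) / 2048)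
    {x0 y0 : ℤ} (hge : D₀ ≤ δ * (y0 - x0)) :
    ∃ (k : ℤ) (M : ℕ), x0 ≤ k ∧ k + 1 ≤ y0 ∧ 3 * D₀ / 8 ≤ |δ * x0 - δ * (k + 1 / 2)| ∧
      3 * D₀ / 8 ≤ |δ * y0 - δ * (k + 1 / 2)| ∧ δ * M + 8 * δ < η ∧
      ∀ j : ℤ, ¬ ∀ m : ℕ, m < M → IsPerfect Ω δ k (j + 1 + m) ∧
        ∀ a c : Bool, infDist (meshPoint δ (corner k (j + 1 + m) a c)) Ωᶜ < r / 2 := by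
  set v : ℝ := volume.real (ball (0 : ℂ) 1) with hv_def
  have hv : 0 < v :=
    ENNReal.toReal_pos (measure_ball_pos volume (0 : ℂ) one_pos).ne' measure_ball_lt_top.ne
  -- the run length `M`
  set M : ℕ := ⌊η / (16 * δ)⌋₊ with hM
  have hMle : (M : ℝ) ≤ η / (16 * δ) := Nat.floor_le (by positivity)
  have hMlt : η / (16 * δ) < M + 1 := Nat.lt_floor_add_one _
  have hkey : η / (16 * δ) * δ = η / 16 := by
    field_simp
  have hM1 : (M : ℝ) * δ ≤ η / 16 := by
    calc (M : ℝ) * δ ≤ η / (16 * δ) * δ := mul_le_mul_of_nonneg_right hMle hδ.le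
      _ = η / 16 := hkey
  have hM2 : η / 32 ≤ (M : ℝ) * δ := by
    have := mul_lt_mul_of_pos_right hMlt hδ
    rw [hkey] at this
    linarith
  have hM8 : δ * M + 8 * δ < η := by linarith
  -- the column range
  set L : ℤ := ⌈3 * D₀ / (8 * δ)⌉ with hL
  have hL1 : 3 * D₀ / (8 * δ) ≤ L := Int.le_ceil _
  have hL2 : (L : ℝ) < 3 * D₀ / (8 * δ) + 1 := Int.ceil_lt_add_one _
  have hq : 0 < D₀ / (8 * δ) := by positivity
  have h38 : 3 * D₀ / (8 * δ) = 3 * (D₀ / (8 * δ)) := by ring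
  have hDδ : D₀ / δ = 8 * (D₀ / (8 * δ)) := by
    field_simp
  have hL0 : (0 : ℤ) ≤ L := by
    have : (0 : ℝ) < L := lt_of_lt_of_le (by positivity) hL1
    exact_mod_cast this.le
  set Kset : Finset ℤ := Finset.Icc (x0 + L + 1) (y0 - L - 1) with hKset
  have hyx : D₀ / δ ≤ (y0 : ℝ) - x0 := by rw [div_le_iff₀ hδ]; linarith
  have hD8 : 8 ≤ D₀ / (8 * δ) := by rw [le_div_iff₀ (by positivity)]; linarith
  have hcard : D₀ / (8 * δ) ≤ (Kset.card : ℝ) := by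
    rw [hKset, Int.card_Icc]
    have h1 : ((y0 - L - 1 + 1 - (x0 + L + 1) : ℤ) : ℝ) ≤ ((y0 - L - 1 + 1 - (x0 + L + 1)).toNat : ℝ) := by
      exact_mod_cast Int.self_le_toNat _
    push_cast at h1
    rw [h38] at hL2
    rw [hDδ] at hyx
    linarith
  -- the area inequality and the good column
  have harea : volume.real {z ∈ Ω | infDist z Ωᶜ < r / 2 + 2 * δ} <
      Kset.card * M * ((δ / 2) ^ 2 * v) := by
    have hmono : volume.real {z ∈ Ω | infDist z Ωᶜ < r / 2 + 2 * δ} ≤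
        volume.real {z ∈ Ω | infDist z Ωᶜ < r} :=
      measureReal_mono (fun z hz => ⟨hz.1, hz.2.trans_le (by linarith)⟩)
        (hΩb.subset fun z hz => hz.1).measure_lt_top.ne
    have hM3 : η / (32 * δ) ≤ M := by rw [div_le_iff₀ (by positivity)]; linarith
    have h1 : D₀ / (8 * δ) * (η / (32 * δ)) ≤ (Kset.card : ℝ) * M :=
      mul_le_mul hcard hM3 (by positivity) (by positivity)
    have h2 : D₀ / (8 * δ) * (η / (32 * δ)) * ((δ / 2) ^ 2 * v) = D₀ * η * v / 1024 := by
      field_simp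
      ring
    have hlow : D₀ * η * v / 1024 ≤ Kset.card * M * ((δ / 2) ^ 2 * v) := by
      rw [← h2]; exact mul_le_mul_of_nonneg_right h1 (by positivity)
    have : D₀ * η * v / 2048 < D₀ * η * v / 1024 := by
      have := mul_pos (mul_pos hD₀ hη) hv; linarith
    linarith
  obtain ⟨k, hk, hgood⟩ := exists_column_forall_not_shallowRun hΩb hδ Kset M harea
  rw [hKset, Finset.mem_Icc] at hk
  obtain ⟨hk1, hk2⟩ := hk
  have hk1' : (x0 : ℝ) + L + 1 ≤ k := by exact_mod_cast hk1
  have hk2' : (k : ℝ) ≤ y0 - L - 1 := by exact_mod_cast hk2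
  have hLD : 3 * D₀ / 8 ≤ δ * L := by
    have : δ * (3 * D₀ / (8 * δ)) = 3 * D₀ / 8 := by
      field_simp
    rw [← this]
    exact mul_le_mul_of_nonneg_left hL1 hδ.le
  refine ⟨k, M, by omega, by omega, ?_, ?_, hM8, hgood⟩
  · rw [abs_sub_comm, abs_of_nonneg (by nlinarith)]; nlinarith
  · rw [abs_of_nonneg (by nlinarith)]; nlinarith

/-! ### The theorem -/

/-- **Stray components have horizontal extent `< D₀`.** See the module docstring. [folklore] -/
theorem _root_.Literature.Probability.RandomPlanarGeometry.JordanDomain.mul_sub_lt_of_stray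
    (D : JordanDomain) {D₀ : ℝ} (hD₀ : 0 < D₀) :
    ∃ ε > 0, ∃ δ₀ > 0, ∀ δ : ℝ, 0 < δ → δ < δ₀ →
      ∀ (x y : meshVertices D.carrier δ), (meshVertexGraph D.carrier δ).Reachable x y →
        (∀ z : meshVertices D.carrier δ, (meshVertexGraph D.carrier δ).Reachable x z →
          infDist (meshPoint δ (z : Site 2)) D.carrierᶜ < ε) →
        δ * ((y : Site 2) 0 - (x : Site 2) 0) < D₀ := by
  have hΩo : IsOpen D.carrier := D.isOpen
  have hΩb : Bornology.IsBounded D.carrier := D.isBounded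
  have hne : D.carrierᶜ.Nonempty := by
    by_contra h
    rw [not_nonempty_iff_eq_empty, compl_empty_iff] at h
    exact NormedSpace.unbounded_univ ℝ ℂ (h ▸ hΩb)
  -- uniform local connectedness of the exterior at radius `D₀/16`
  obtain ⟨η₀, hη₀, hulc₀⟩ := D.exterior_joinedIn_of_dist_lt (show 0 < D₀ / 16 by positivity)
  set η := min η₀ (D₀ / 16) with hηdef
  have hη : 0 < η := lt_min hη₀ (by positivity)
  have hηD : η ≤ D₀ / 16 := min_le_right _ _
  have hulc : ∀ a ∈ (closure D.carrier)ᶜ, ∀ b ∈ (closure D.carrier)ᶜ, dist a b < η →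
      JoinedIn ((closure D.carrier)ᶜ ∩ ball a (D₀ / 16)) a b := fun a ha b hb hab =>
    hulc₀ a ha b hb (hab.trans_le (min_le_left _ _))
  -- the area budget
  have hv : 0 < volume.real (ball (0 : ℂ) 1) :=
    ENNReal.toReal_pos (measure_ball_pos volume (0 : ℂ) one_pos).ne' measure_ball_lt_top.ne
  have hApos : 0 < D₀ * η * volume.real (ball (0 : ℂ) 1) / 2048 := by positivity
  obtain ⟨r, hr, hcollar⟩ := exists_pos_volume_real_innerCollar_lt hΩo hΩb hne hApos
  refine ⟨r / 2, by positivity, min (r / 4) (min (η / 64) (D₀ / 64)), by positivity, ?_⟩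
  intro δ hδ hδlt x y hreach hstray
  have hδr : δ ≤ r / 4 := hδlt.le.trans (min_le_left _ _)
  have hδη : δ < η / 64 := hδlt.trans_le ((min_le_right _ _).trans (min_le_left _ _))
  have hδD : δ < D₀ / 64 := hδlt.trans_le ((min_le_right _ _).trans (min_le_right _ _))
  by_contra hge
  push Not at hge
  obtain ⟨k, M, hk1, hk2, hxfar, hyfar, hM8, hgood⟩ :=
    exists_goodColumn hΩb hδ hη hD₀ hδη hδD hδr hcollar hge
  -- the walk: odd and even rung counts
  obtain ⟨P⟩ := hreach
  obtain ⟨W, hWs, hWd⟩ := exists_zdWalk P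
  have hodd : Odd (kRungCount k W) := odd_kRungCount k W hk1 hk2
  have heven : Even (kRungCount k W) :=
    even_kRungCount_of_good D hδ hD₀ hηD hulc hM8 hgood hstray W hWs hWd hxfar hyfar
  exact (Nat.not_even_iff_odd.2 hodd) heven

end

end Literature.Probability.LatticeModels.Mesh
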